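import Summits.CriticalPhenomena.PercolationContinuityZ3.Theorems.PercNearOneGluingNoHeavyLowerTailSahiCombShape

/-!
# The comb (tensor-Bernstein) hierarchy for Sahi's `E_k`, VI: peeling one coordinate off the copies, and the level `k = 2`
# of every shape law as a THEOREM (fibrewise law of total covariance)

Support file of the one-cut programme (crux `NoHeavyLowerTail`, stmt-CriticalPhenomena-4575; cell `prim-masterthm`, seat P5;
report `run/shared/lean/prim/prim-masterthm/prim-masterthm-p5/P5-LORENTZIAN-TEST.md` §7.2 (RR₂ / concavity of `Cov` in each
`p_e`: `c_1 = c_0 + c_2 + Δ_UΔ_V`) and §7.3).  Honest label: the shape laws of `…SahiCombShape` are OPEN for `k ≥ 3`; this file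
proves their level `k = 2` and the coordinate-peeling identities that any level needs.

* `SahiComb.insAt / stripAt / openAt` and **`SahiComb.sum_fibre_update`** — the FIBRE DECOMPOSITION along an axis `e`: the
  profile fibre `j[e ↦ t]` of `(2^ι)^n` is the disjoint union over the `t`-sets `T` of copies of the images of the fibre
  `j[e ↦ 0]` under "open `e` in the copies of `T`" (an explicit `Finset.sum_nbij'`);
* `SahiComb.copyKernel_congr₂` (locality across two copy tuples) and **`SahiComb.combCoeff_update_of_ignores`**: along an axis
  that every `f_i` ignores, the coefficient line is BINOMIAL, `c_t = C(n,t)·c_0` (degree elevation; hence trivially unimodal);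
  `SahiComb.combCoeff_ind_update_top_eq_secAt_true`: the `t = n` end of a line is the `t = 0` coefficient of the `e ← 1` sections;
* `SahiComb.copyKernel_two` (`K_2(f)(ω_0,ω_1) = f_0(ω_1)f_1(ω_1) − f_0(ω_0)f_1(ω_1)`), the cross term `SahiComb.crossTwo`
  (`Σ_{fibre} (1_{U¹}−1_{U⁰})(ω_0)(1_{V¹}−1_{V⁰})(ω_1) ≥ 0`, `crossTwo_nonneg`) and **`SahiComb.combLine_two_one_eq`** — the
  FIBREWISE LAW OF TOTAL COVARIANCE: `c_1(U,V) = c_0(U⁰,V⁰) + c_0(U¹,V¹) + crossTwo`;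
* consequences, all THEOREMS at `k = 2`: `combEndPos_two`, **`masterFamilyCombCoeffNonneg_two`** ((M⁺-2) with THE coefficients
  — the tree's third proof of the `k = 2` row, here by the coordinate induction `masterFamilyCombCoeffNonneg_iff_combEndPos`),
  `combOrderOne_two` (`c_0, c_2 ≤ c_1`), `combEndMin_two`, `combUnimodal_two` (mode at `t = 1`).
Everything here is proved; axioms standard. [this work]
-/

noncomputable section

open scoped Classical

namespace Summit.CriticalPhenomena.PercolationContinuityZ3.Theorems

open Finset Function
open Literature.Combinatorics.Sahi2008
open Literature.Probability.Percolation (DeterminedBy determinedBy_iff)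
open Literature.Probability.Percolation.DecisionTree (ind ind_of_mem ind_of_not_mem ind_nonneg)
open SahiComb

/-! ### Peeling one coordinate off the copies: the fibre decomposition along an axis -/

namespace SahiComb

section Peel

variable {ι : Type*} [Fintype ι] {n : ℕ}

/-- Open the coordinate `e` in the copies indexed by `T`. [this work] -/
def insAt (e : ι) (T : Finset (Fin n)) (ω : Fin n → Set ι) : Fin n → Set ι :=
  fun c => if c ∈ T then insert e (ω c) else ω c

/-- Close the coordinate `e` in every copy. [this work] -/
def stripAt (e : ι) (ω : Fin n → Set ι) : Fin n → Set ι := fun c => ω c \ {e}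

/-- The set of copies open at `e`. [this work] -/
def openAt (e : ι) (ω : Fin n → Set ι) : Finset (Fin n) := univ.filter fun c => e ∈ ω c

omit [Fintype ι] in
/-- `profile ω e = #openAt e ω`. [this work] -/
theorem profile_apply_eq_card_openAt (e : ι) (ω : Fin n → Set ι) : profile ω e = (openAt e ω).card := rfl

omit [Fintype ι] in
/-- A tuple has `e`-profile `0` iff every copy is closed at `e`. [this work] -/
theorem profile_apply_eq_zero_iff (e : ι) (ω : Fin n → Set ι) : profile ω e = 0 ↔ ∀ c, e ∉ ω c := by
  unfold profile
  rw [card_eq_zero, filter_eq_empty_iff]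
  exact ⟨fun h c => h (mem_univ c), fun h c _ => h c⟩

omit [Fintype ι] in
/-- Off `e`, opening `e` in some copies does not change the profile; at `e` it becomes `#T` (for an `e`-closed tuple).
[this work] -/
theorem profile_insAt (e : ι) (T : Finset (Fin n)) {ω : Fin n → Set ι} (hω : ∀ c, e ∉ ω c) :
    profile (insAt e T ω) = update (profile ω) e T.card := by
  funext e'
  by_cases he : e' = e
  · subst he
    rw [update_self]
    unfold profile insAt
    congr 1
    ext c
    simp only [mem_filter, mem_univ, true_and]
    constructor
    · intro h
      by_contra hc
      rw [if_neg hc] at h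
      exact hω c h
    · intro hc
      rw [if_pos hc]
      exact Set.mem_insert _ _
  · rw [update_of_ne he]
    unfold profile insAt
    congr 1
    ext c
    simp only [mem_filter, mem_univ, true_and]
    split_ifs
    · exact ⟨fun h => (Set.mem_insert_iff.1 h).resolve_left he, fun h => Set.mem_insert_of_mem _ h⟩
    · exact Iff.rfl

omit [Fintype ι] in
/-- Closing `e` everywhere kills the `e`-profile and keeps the rest. [this work] -/
theorem profile_stripAt (e : ι) (ω : Fin n → Set ι) : profile (stripAt e ω) = update (profile ω) e 0 := by
  funext e'
  by_cases he : e' = e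
  · subst he
    rw [update_self, profile_apply_eq_zero_iff]
    intro c
    simp [stripAt]
  · rw [update_of_ne he]
    unfold profile stripAt
    congr 1
    ext c
    simp [he]

omit [Fintype ι] in
/-- `insAt ∘ (openAt, stripAt) = id`. [this work] -/
theorem insAt_openAt_stripAt (e : ι) (ω : Fin n → Set ι) : insAt e (openAt e ω) (stripAt e ω) = ω := by
  funext c
  unfold insAt openAt stripAt
  simp only [mem_filter, mem_univ, true_and]
  split_ifs with h
  · exact Set.insert_sdiff_self_of_mem h
  · exact Set.sdiff_singleton_eq_self h

omit [Fintype ι] in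
/-- `openAt (insAt T ω) = T` for an `e`-closed tuple. [this work] -/
theorem openAt_insAt (e : ι) (T : Finset (Fin n)) {ω : Fin n → Set ι} (hω : ∀ c, e ∉ ω c) :
    openAt e (insAt e T ω) = T := by
  have h := congrFun (profile_insAt e T hω) e
  rw [update_self] at h
  -- same filter as in `profile_insAt`; redo the membership computation
  ext c
  unfold openAt insAt
  simp only [mem_filter, mem_univ, true_and]
  constructor
  · intro h'
    by_contra hc
    rw [if_neg hc] at h'
    exact hω c h'
  · intro hc
    rw [if_pos hc]
    exact Set.mem_insert _ _

omit [Fintype ι] in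
/-- `stripAt (insAt T ω) = ω` for an `e`-closed tuple. [this work] -/
theorem stripAt_insAt (e : ι) (T : Finset (Fin n)) {ω : Fin n → Set ι} (hω : ∀ c, e ∉ ω c) :
    stripAt e (insAt e T ω) = ω := by
  funext c
  unfold stripAt insAt
  split_ifs
  · exact Set.insert_sdiff_self_of_notMem (hω c)
  · exact Set.sdiff_singleton_eq_self (hω c)

/-- **Fibre decomposition along an axis**: the profile fibre `j[e ↦ t]` is the disjoint union, over the `t`-sets `T` of copies,
of the images of the fibre `j[e ↦ 0]` under "open `e` in the copies of `T`". [this work] -/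
theorem sum_fibre_update (G : (Fin n → Set ι) → ℝ) (j : ι → ℕ) (e : ι) (t : ℕ) :
    ∑ ω ∈ univ.filter (fun ω : Fin n → Set ι => profile ω = update j e t), G ω =
      ∑ T ∈ powersetCard t univ,
        ∑ ω ∈ univ.filter (fun ω : Fin n → Set ι => profile ω = update j e 0), G (insAt e T ω) := by
  rw [← sum_product']
  have hfree : ∀ ω : Fin n → Set ι, profile ω = update j e 0 → ∀ c, e ∉ ω c := fun ω h =>
    (profile_apply_eq_zero_iff e ω).1 (by rw [h, update_self])
  refine sum_nbij' (fun ω => (openAt e ω, stripAt e ω)) (fun q => insAt e q.1 q.2) ?_ ?_ ?_ ?_ ?_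
  · intro ω hω
    have hp := (mem_filter.1 hω).2
    refine mem_product.2 ⟨mem_powersetCard.2 ⟨subset_univ _, ?_⟩, mem_filter.2 ⟨mem_univ _, ?_⟩⟩
    · rw [← profile_apply_eq_card_openAt, hp, update_self]
    · rw [profile_stripAt, hp, update_idem]
  · rintro ⟨T, ω⟩ hq
    obtain ⟨hT, hω⟩ := mem_product.1 hq
    have hp := (mem_filter.1 hω).2
    refine mem_filter.2 ⟨mem_univ _, ?_⟩
    rw [profile_insAt e T (hfree ω hp), hp, update_idem, (mem_powersetCard.1 hT).2]
  · intro ω _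
    exact insAt_openAt_stripAt e ω
  · rintro ⟨T, ω⟩ hq
    obtain ⟨-, hω⟩ := mem_product.1 hq
    have hf := hfree ω (mem_filter.1 hω).2
    exact Prod.ext (openAt_insAt e T hf) (stripAt_insAt e T hf)
  · intro ω _
    rw [insAt_openAt_stripAt]

/-- **Locality, two tuples**: the kernel reads only the values `f_i(ω_c)`, so `K(f)(ω) = K(g)(ω')` as soon as
`f_i(ω_c) = g_i(ω'_c)` for all slots `i` and copies `c`. [this work] -/
theorem copyKernel_congr₂ {α : Type*} : ∀ (n : ℕ) {f g : Fin n → α → ℝ} {ω ω' : Fin n → α},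
    (∀ i c, f i (ω c) = g i (ω' c)) → copyKernel n f ω = copyKernel n g ω'
  | 0, _, _, _, _, _ => rfl
  | 1, _, _, _, _, h => h 0 0
  | n + 2, f, g, ω, ω', h => by
    rw [copyKernel_succ_succ, copyKernel_succ_succ]
    have ht : ∀ i c, Fin.tail f i (Fin.tail ω c) = Fin.tail g i (Fin.tail ω' c) := fun i c => h i.succ c.succ
    rw [copyKernel_congr₂ (n + 1) ht, h 0 0]
    congr 1
    refine sum_congr rfl fun i _ => copyKernel_congr₂ (n + 1) fun i' c => ?_
    by_cases hi : i' = i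
    · subst hi
      simp only [update_self, Pi.mul_apply]
      rw [ht, show f 0 (Fin.tail ω c) = g 0 (Fin.tail ω' c) from h 0 c.succ]
    · simp only [update_of_ne hi]
      exact ht i' c

/-- **Lines along an ignored axis are binomial**: if every `f_i` ignores `e` then
`combCoeff(f; j[e ↦ t]) = C(n,t) · combCoeff(f; j[e ↦ 0])` (degree elevation; such lines are trivially unimodal). [this work] -/
theorem combCoeff_update_of_ignores {f : Fin n → Set ι → ℝ} {e : ι} (hf : ∀ i ω, f i (insert e ω) = f i ω)
    (j : ι → ℕ) (t : ℕ) : combCoeff n f (update j e t) = (n.choose t : ℝ) * combCoeff n f (update j e 0) := by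
  unfold combCoeff
  rw [sum_fibre_update]
  have h : ∀ T ∈ powersetCard t (univ : Finset (Fin n)),
      ∑ ω ∈ univ.filter (fun ω : Fin n → Set ι => profile ω = update j e 0), copyKernel n f (insAt e T ω) =
        ∑ ω ∈ univ.filter (fun ω : Fin n → Set ι => profile ω = update j e 0), copyKernel n f ω :=
    fun T _ => sum_congr rfl fun ω _ => copyKernel_congr₂ n fun i c => by
      unfold insAt
      split_ifs
      · exact hf i _
      · rfl
  rw [sum_congr rfl h, sum_const, card_powersetCard, card_univ, Fintype.card_fin, nsmul_eq_mul]

/-- The `j_e = n` face in terms of the `j_e = 0` profile of the `e ← true` sections (face lemma + ignored axis). [this work] -/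
theorem combCoeff_ind_update_top_eq_secAt_true (U : Fin n → Set (Set ι)) (e : ι) (j : ι → ℕ) :
    combCoeff n (fun i => ind (U i)) (update j e n) = combCoeff n (fun i => ind (secAt e true (U i))) (update j e 0) := by
  rw [combCoeff_ind_eq_secAt_true U e (update_self e n j),
    combCoeff_update_of_ignores (fun i ω => ind_secAt_insert e true (U i) ω), Nat.choose_self, Nat.cast_one, one_mul]

end Peel

/-! ### The level `k = 2` explicitly: the law of total covariance on the fibres -/

section Two

variable {ι : Type*} [Fintype ι]

omit [Fintype ι] in
/-- `K_2(f)(ω_0, ω_1) = f_0(ω_1)f_1(ω_1) − f_0(ω_0)f_1(ω_1)`. [this work] -/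
theorem copyKernel_two {α : Type*} (f : Fin 2 → α → ℝ) (ω : Fin 2 → α) :
    copyKernel 2 f ω = f 0 (ω 1) * f 1 (ω 1) - f 0 (ω 0) * f 1 (ω 1) := by
  show (∑ i : Fin 1, copyKernel 1 (update (Fin.tail f) i (Fin.tail f i * f 0)) (Fin.tail ω)) -
      copyKernel 1 (Fin.tail f) (Fin.tail ω) * f 0 (ω 0) = _
  rw [Fin.sum_univ_one, copyKernel_one, copyKernel_one, update_self, Pi.mul_apply]
  simp only [Fin.tail]
  show f (Fin.succ 0) (ω (Fin.succ 0)) * f 0 (ω (Fin.succ 0)) - f (Fin.succ 0) (ω (Fin.succ 0)) * f 0 (ω 0) = _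
  simp only [Fin.succ_zero_eq_one]
  ring

/-- The cross ("influence") term of the fibrewise law of total covariance:
`D = Σ_{fibre j[e↦0]} (1_{U_0¹} − 1_{U_0⁰})(ω_0)·(1_{U_1¹} − 1_{U_1⁰})(ω_1)`. [this work] -/
def crossTwo (U : Fin 2 → Set (Set ι)) (e : ι) (j : ι → ℕ) : ℝ :=
  ∑ ω ∈ univ.filter (fun ω : Fin 2 → Set ι => profile ω = update j e 0),
    (ind (secAt e true (U 0)) (ω 0) - ind (secAt e false (U 0)) (ω 0)) *
      (ind (secAt e true (U 1)) (ω 1) - ind (secAt e false (U 1)) (ω 1))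

omit [Fintype ι] in
/-- The two sections of an increasing event are nested: `U^{e←0} ⊆ U^{e←1}` (local copy of the tree's
`secAt_false_subset_true` of `SahiMasterFamilyTrichotomy`, kept private to keep the imports light). [folklore] -/
private theorem secAt_false_sub_true (e : ι) {U : Set (Set ι)} (hU : IsUpperSet U) : secAt e false U ⊆ secAt e true U := by
  intro ω hω
  rw [mem_secAt] at hω ⊢
  simp only [forceAt, cond_false, cond_true] at hω ⊢
  exact hU (Set.sdiff_subset.trans (Set.subset_insert e ω)) hω

/-- The cross term is `≥ 0` for increasing events (sections are nested). [this work] -/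
theorem crossTwo_nonneg (U : Fin 2 → Set (Set ι)) (hU : ∀ i, IsUpperSet (U i)) (e : ι) (j : ι → ℕ) :
    0 ≤ crossTwo U e j := by
  have hle : ∀ i ω, ind (secAt e false (U i)) ω ≤ ind (secAt e true (U i)) ω := fun i ω => by
    by_cases h0 : ω ∈ secAt e false (U i)
    · rw [ind_of_mem h0, ind_of_mem (secAt_false_sub_true e (hU i) h0)]
    · rw [ind_of_not_mem h0]; exact ind_nonneg _ ω
  exact sum_nonneg fun ω _ => mul_nonneg (sub_nonneg.2 (hle 0 _)) (sub_nonneg.2 (hle 1 _))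

/-- **The middle of a `k = 2` line, fibrewise law of total covariance**:
`c_1(U_0,U_1) = c_0(U⁰) + c_0(U¹) + D` with `D ≥ 0` the cross term. [this work] -/
theorem combLine_two_one_eq (U : Fin 2 → Set (Set ι)) (e : ι) (j : ι → ℕ) :
    combLine 2 U e j 1 =
      combLine 2 (fun i => secAt e false (U i)) e j 0 + combLine 2 (fun i => secAt e true (U i)) e j 0
        + crossTwo U e j := by
  unfold combLine combCoeff crossTwo
  rw [sum_fibre_update, powersetCard_one, sum_map, Fin.sum_univ_two, ← sum_add_distrib, ← sum_add_distrib,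
    ← sum_add_distrib]
  refine sum_congr rfl fun ω hω => ?_
  have hfree : ∀ c, e ∉ ω c :=
    (profile_apply_eq_zero_iff e ω).1 (by rw [(mem_filter.1 hω).2, update_self])
  have hT : ∀ (X : Set (Set ι)) (c : Fin 2), ind X (insert e (ω c)) = ind (secAt e true X) (ω c) := fun X c => by
    rw [ind_secAt_true_of_mem e X (Set.mem_insert e (ω c)), ind_secAt_insert]
  have hF : ∀ (X : Set (Set ι)) (c : Fin 2), ind X (ω c) = ind (secAt e false X) (ω c) := fun X c =>
    ind_secAt_false_of_notMem e X (hfree c)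
  simp only [copyKernel_two, insAt, Function.Embedding.coeFn_mk, mem_singleton]
  simp only [Fin.isValue, if_true, one_ne_zero, if_false, zero_ne_one]
  rw [hT, hT, hT, hF (U 0) 0, hF (U 0) 1, hF (U 1) 1]
  ring

end Two

end SahiComb

/-! ### The level `k = 2` of every shape law is a theorem -/

section LevelTwo

open SahiComb

/-- **ENDPOS(2) is a theorem.** [this work] -/
theorem combEndPos_two : CombEndPos 2 := by
  intro ι _ U hU e j t ht h0 h2
  interval_cases t
  · exact h0
  · rw [combLine_two_one_eq]
    have h0' : 0 ≤ combLine 2 (fun i => secAt e false (U i)) e j 0 := by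
      unfold combLine; rwa [← combCoeff_ind_eq_secAt_false U e (update_self e 0 j)]
    have h2' : 0 ≤ combLine 2 (fun i => secAt e true (U i)) e j 0 := by
      unfold combLine; rwa [← combCoeff_ind_update_top_eq_secAt_true U e j]
    exact add_nonneg (add_nonneg h0' h2') (crossTwo_nonneg U hU e j)
  · exact h2

/-- **(M⁺-2) with explicit coefficients is a theorem**: every two-copy comb coefficient of the covariance of two increasing
events is `≥ 0` (the tree's third proof of the `k = 2` row, after `TwoPartition.twoPartN_nonneg` and P3's existential
`masterFamilyCombPos_two`; here by the coordinate induction of ENDPOS). [this work] -/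
theorem masterFamilyCombCoeffNonneg_two : MasterFamilyCombCoeffNonneg 2 :=
  (masterFamilyCombCoeffNonneg_iff_combEndPos 2).2 combEndPos_two

/-- **ORDER-1(2) is a theorem**: `c_0 ≤ c_1` and `c_2 ≤ c_1` on every line of the two-copy comb array. [this work] -/
theorem combOrderOne_two : CombOrderOne 2 := by
  intro _ ι _ U hU e j
  have hsec : ∀ (b : Bool) (i : Fin 2), IsUpperSet (secAt e b (U i)) := fun b i => isUpperSet_secAt e b (hU i)
  have h0' : 0 ≤ combLine 2 (fun i => secAt e false (U i)) e j 0 :=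
    masterFamilyCombCoeffNonneg_two ι _ (hsec false) _
  have h2' : 0 ≤ combLine 2 (fun i => secAt e true (U i)) e j 0 :=
    masterFamilyCombCoeffNonneg_two ι _ (hsec true) _
  have hD := crossTwo_nonneg U hU e j
  have h0 : combLine 2 U e j 0 = combLine 2 (fun i => secAt e false (U i)) e j 0 := by
    unfold combLine; rw [combCoeff_ind_eq_secAt_false U e (update_self e 0 j)]
  have h2 : combLine 2 U e j 2 = combLine 2 (fun i => secAt e true (U i)) e j 0 := by
    unfold combLine; rw [combCoeff_ind_update_top_eq_secAt_true U e j]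
  refine ⟨?_, ?_⟩
  · rw [combLine_two_one_eq, h0]; linarith
  · rw [show (2 - 1 : ℕ) = 1 from rfl, combLine_two_one_eq, h2]; linarith

/-- **ENDMIN(2) is a theorem.** [this work] -/
theorem combEndMin_two : CombEndMin 2 := by
  intro ι _ U hU e j t ht
  obtain ⟨h01, h21⟩ := combOrderOne_two (le_refl 2) ι U hU e j
  interval_cases t
  · exact min_le_left _ _
  · exact (min_le_left _ _).trans h01
  · exact min_le_right _ _

/-- **UNI(2) is a theorem** (mode at `t = 1`). [this work] -/
theorem combUnimodal_two : CombUnimodal 2 := by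
  intro ι _ U hU e j
  obtain ⟨h01, h21⟩ := combOrderOne_two (le_refl 2) ι U hU e j
  refine ⟨1, by norm_num, ?_, ?_⟩
  · intro a ha b hb hab
    rcases Nat.le_one_iff_eq_zero_or_eq_one.1 ha.2 with rfl | rfl <;>
      rcases Nat.le_one_iff_eq_zero_or_eq_one.1 hb.2 with rfl | rfl
    · exact le_rfl
    · exact h01
    · exact absurd hab (by norm_num)
    · exact le_rfl
  · intro a ha b hb hab
    have ha' : a = 1 ∨ a = 2 := by rcases ha with ⟨h1, h2⟩; omega
    have hb' : b = 1 ∨ b = 2 := by rcases hb with ⟨h1, h2⟩; omega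
    rcases ha' with rfl | rfl <;> rcases hb' with rfl | rfl
    · exact le_rfl
    · exact h21
    · exact absurd hab (by norm_num)
    · exact le_rfl

end LevelTwo

end Summit.CriticalPhenomena.PercolationContinuityZ3.Theorems
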